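import Std.Sat.CNF.Literal
import Mathlib.Computability.Encoding
import Mathlib.Computability.Language
import Mathlib.Data.Finset.Lattice.Fold
import Mathlib.Data.Fintype.Pi
import Mathlib.Data.Rat.Defs
import Mathlib.Algebra.Order.Ring.Rat
import Literature.Computability.Complexity.BoolEncodings
import Literature.Computability.Complexity.Classes
import Literature.Computability.Complexity.Nondeterministic
import Literature.Computability.Complexity.Reductions
import HarnessLib

-- provenance: harness21/H21/H21/Prelude/CplxCore/CNF.lean @ aa07551 (interim HEAD d8f2665); M5 mechanical rewrite
/-!
# Complexity core: propositional formulas, CNFs and the SAT-type languages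

Trunk `CplxCore`, concept C6 (`CNF`; outline D6): math-level conjunctive normal forms and
propositional formulas, their Boolean encodings, and the languages `SAT`, `kSAT k`, `EkSAT k`,
`UNSAT`, `kUNSAT k`, `TAUT`, `kTAUT k` over Cook's alphabet `{0,1}` (`Language Bool`), obtained
via `Computability.Encoding.toLanguage`.

## Mathlib / core search

* Mathlib's `Sat.Fmla`, `Sat.Clause`, `Sat.Literal` (`Mathlib/Tactic/Sat/FromLRAT.lean`) are
  tactic infrastructure (literals reified as `Prop`s); not reused.
* Core's `Std.Sat.Literal α := α × Bool` and `Std.Sat.CNF` (`Std/Sat/CNF/*.lean`) support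
  `bv_decide`; `Std.Sat.CNF` is `Array`-based in this toolchain and has no width / variable-set /
  encoding API. Not reused, but we stay *definitionally compatible*: `Literal ν := ν × Bool` is
  `Std.Sat.Literal ν` on the nose (`.1` = variable, `.2` = polarity) with the same semantics
  `σ l.1 == l.2`.
* Mathlib has no propositional-formula syntax type outside `ModelTheory` (first-order
  `BoundedFormula`, far too heavy for TAUT); hence our own `PropForm ν`.

## Bridge to `Literature.Computability.FineGrained.KCNF` (no import of the statements file)

`Literature.FineGrained.KCNF k` (in `H21/Statements/FineGrained/Wave0.lean`) is the structure
`{numVars, clauses : List (List (ℕ × Bool)), fst_lt_numVars, length_le}`; so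
`φ.clauses : CNF ℕ` on the nose, the two proof fields say `CNF.IsWidthLE k φ.clauses` and
"all variables `< numVars`", and `KCNF.eval φ v = CNF.eval φ.clauses v` holds by `rfl`
(both are `clauses.all fun c => c.any fun l => v l.1 == l.2`; verified in the architect's probe).

## Design notes

* Variables `ν : Type*` for the syntax; encodings and languages at `ν = ℕ`.
* `CNF.eval φ σ` takes the formula first (dot notation `φ.eval σ`); `Literal.eval σ l` and
  `Clause.eval σ c` take the assignment first so that they can be passed to `List.any/all`.
* No global `Decidable φ.Satisfiable` instance is registered (only `DecidableEq` on syntax).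
* `CNF.satisfiedFraction [] σ = 1` and hence `CNF.maxSatFraction [] = 1` (documented junk /
  vacuous convention: every clause of the empty CNF is satisfied); consequently gap statements
  such as `gapE3SAT_disjoint` need `ε < 1/8` (outline R10).
* Encodings have real `decode_encode` proofs (outline R12): literals and CNFs via the
  `pairBool`/`listBool` combinators of `BoolEncodings`; `PropForm ℕ` via a prefix code
  (`PropForm.code`) with a fuel-indexed decoder, the fuel `φ.size` being transmitted in unary
  through `boolPair`.
* Sanity statements (`SAT_mem_NP`, …) are `sorry`d: routine machine constructions.

## References

* S. A. Cook, *The complexity of theorem-proving procedures*, STOC 1971, Thm 1–2 (SAT, 3SAT,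
  tautologies).
* R. M. Karp, *Reducibility among combinatorial problems*, 1972, §4 (SATISFIABILITY, 3-SAT).
* S. Arora, B. Barak, *Computational Complexity: A Modern Approach*, CUP 2009, §2.3
  (Def. 2.9 CNF, kCNF; SAT, 3SAT), Example 2.21 (TAUTOLOGY ∈ coNP), §11.2 (MAX-3SAT, `val(φ)`),
  §22.4 (E3SAT / Håstad).
* M. Sipser, *Introduction to the Theory of Computation*, 3rd ed., §7.4 (SAT, 3SAT, CNF).
-/

namespace Literature.Computability.Complexity

open _root_.Computability

universe u

variable {ν : Type u}

/-! ### Literals, clauses, CNFs -/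

/-- A literal over variables `ν`: a pair `(x, b)` of a variable `x = l.1` and a polarity
`b = l.2` (`true` = positive literal `x`, `false` = negated literal `¬x`). Definitionally
`Std.Sat.Literal ν`. [Arora–Barak 2009, Def. 2.9; `Std.Sat.Literal`] [cite: AroraBarak2009, Def. 2.9] -/
abbrev Literal (ν : Type u) : Type u := ν × Bool

/-- Compatibility with core: `Literal ν` is `Std.Sat.Literal ν` definitionally (outline D6).
[`Std.Sat.Literal`] [folklore] -/
theorem literal_eq_stdSatLiteral (ν : Type u) : Literal ν = Std.Sat.Literal ν := rfl

/-- A clause is a list of literals, read disjunctively (for CNFs) or conjunctively (for DNFs).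
[Arora–Barak 2009, Def. 2.9] [cite: AroraBarak2009, Def. 2.9] -/
abbrev Clause (ν : Type u) : Type u := List (Literal ν)

/-- A CNF formula is a list of clauses, read as the conjunction of the disjunctions of their
literals. (The same data read as a disjunction of conjunctions is a DNF, see `CNF.evalDNF`.)
Definitionally the type of `Literature.Computability.FineGrained.KCNF.clauses` at `ν = ℕ`.
[Arora–Barak 2009, Def. 2.9; Cook 1971, §1] [cite: AroraBarak2009, Def. 2.9] -/
abbrev CNF (ν : Type u) : Type u := List (Clause ν)

/-- The value of a literal under an assignment `σ : ν → Bool`: `(x, b)` is true iff `σ x = b`.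
Same semantics as `Std.Sat.Literal` / `Literature.Computability.FineGrained.KCNF.eval`. [Arora–Barak 2009, Def. 2.9] [cite: AroraBarak2009, Def. 2.9] -/
def Literal.eval (σ : ν → Bool) (l : Literal ν) : Bool :=
  σ l.1 == l.2

/-- The negation of a literal (flip the polarity). [Arora–Barak 2009, Def. 2.9] [cite: AroraBarak2009, Def. 2.9] -/
def Literal.negate (l : Literal ν) : Literal ν :=
  (l.1, !l.2)

/-- Negating a literal negates its value. [Arora–Barak 2009, Def. 2.9] [cite: AroraBarak2009, Def. 2.9] -/
@[simp] theorem Literal.eval_negate (σ : ν → Bool) (l : Literal ν) :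
    l.negate.eval σ = !l.eval σ := by
  rcases l with ⟨x, b⟩
  cases b <;> cases h : σ x <;> simp [Literal.eval, Literal.negate, h]

/-- The (disjunctive) value of a clause: some literal is true. [Arora–Barak 2009, Def. 2.9] [cite: AroraBarak2009, Def. 2.9] -/
def Clause.eval (σ : ν → Bool) (c : Clause ν) : Bool :=
  c.any (Literal.eval σ)

/-- The value of a CNF under an assignment: every clause contains a true literal. Written as
`φ.all fun c => c.any (Literal.eval σ)` so that `KCNF.eval φ v = CNF.eval φ.clauses v` is `rfl`.
[Arora–Barak 2009, Def. 2.9; Cook 1971, §1] [cite: AroraBarak2009, Def. 2.9] -/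
def CNF.eval (φ : CNF ν) (σ : ν → Bool) : Bool :=
  φ.all fun c => c.any (Literal.eval σ)

/-- A CNF is satisfiable if some (total) assignment makes it true.
[Cook 1971, §1; Arora–Barak 2009, §2.3] [cite: Cook1971, §1] -/
def CNF.Satisfiable (φ : CNF ν) : Prop :=
  ∃ σ : ν → Bool, φ.eval σ = true

/-- The value of the same clause list read as a DNF (disjunction of conjunctions of literals):
some clause has all its literals true. [Arora–Barak 2009, §2.3 (CNF/DNF)] [cite: AroraBarak2009, §2.3 (CNF/DNF] -/
def CNF.evalDNF (φ : CNF ν) (σ : ν → Bool) : Bool :=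
  φ.any fun c => c.all (Literal.eval σ)

/-- A clause list is a DNF tautology if, read as a DNF, it is true under every assignment
(the complement of CNF unsatisfiability under literal-wise negation).
[Cook 1971, Thm 2 (DNF tautologies); Arora–Barak 2009, Example 2.21] [cite: Cook1971, Thm 2 (DNF tautologies] -/
def CNF.IsDNFTautology (φ : CNF ν) : Prop :=
  ∀ σ : ν → Bool, φ.evalDNF σ = true

namespace CNF

/-- The empty CNF is true. [Arora–Barak 2009, Def. 2.9] [cite: AroraBarak2009, Def. 2.9] -/
@[simp] theorem eval_nil (σ : ν → Bool) : CNF.eval ([] : CNF ν) σ = true := rfl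

/-- Unfolding `CNF.eval` on a cons. [Arora–Barak 2009, Def. 2.9] [cite: AroraBarak2009, Def. 2.9] -/
@[simp] theorem eval_cons (c : Clause ν) (φ : CNF ν) (σ : ν → Bool) :
    CNF.eval (c :: φ) σ = (c.eval σ && φ.eval σ) := rfl

/-- A CNF is true iff all its clauses are. [Arora–Barak 2009, Def. 2.9] [cite: AroraBarak2009, Def. 2.9] -/
theorem eval_eq_true_iff (φ : CNF ν) (σ : ν → Bool) :
    φ.eval σ = true ↔ ∀ c ∈ φ, c.eval σ = true := by
  simp [CNF.eval, Clause.eval, List.all_eq_true]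

/-- The empty CNF is satisfiable (by any assignment; `ν` may be empty since assignments are
functions). [Arora–Barak 2009, §2.3] [cite: AroraBarak2009, §2.3] -/
theorem satisfiable_nil : CNF.Satisfiable ([] : CNF ν) :=
  ⟨fun _ => false, rfl⟩

/-- A CNF containing the empty clause is unsatisfiable. [Arora–Barak 2009, §2.3] [cite: AroraBarak2009, §2.3] -/
theorem not_satisfiable_of_nil_mem {φ : CNF ν} (h : ([] : Clause ν) ∈ φ) : ¬ φ.Satisfiable := by
  rintro ⟨σ, hσ⟩
  have := (eval_eq_true_iff φ σ).1 hσ [] h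
  simp [Clause.eval] at this

/-! ### Size measures and width -/

/-- The set of variables occurring in a CNF. [Arora–Barak 2009, Def. 2.9] [cite: AroraBarak2009, Def. 2.9] -/
def vars [DecidableEq ν] (φ : CNF ν) : Finset ν :=
  (φ.flatten.map Prod.fst).toFinset

/-- The number of variables of a CNF over `ℕ`, in the sense of "variables are `x₀, …, x_{n-1}`":
`1 + ` the largest variable index occurring, and `0` if no variable occurs.
[Impagliazzo–Paturi 2001, §1 (`n` = number of variables); Arora–Barak 2009, §2.3] [cite: ImpagliazzoPaturi2001, §1 ( n  = number of variables] -/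
def numVars (φ : CNF ℕ) : ℕ :=
  (φ.flatten.map fun l => l.1 + 1).foldr max 0

/-- The number of clauses `m` of a CNF. [Arora–Barak 2009, Def. 2.9] [cite: AroraBarak2009, Def. 2.9] -/
def numClauses (φ : CNF ν) : ℕ :=
  φ.length

/-- The size of a CNF: the total number of literal occurrences `∑ᵢ |Cᵢ|`.
[Arora–Barak 2009, Def. 2.9 (size of a CNF)] [cite: AroraBarak2009, Def. 2.9 (size of a CNF] -/
def size (φ : CNF ν) : ℕ :=
  (φ.map List.length).sum

/-- `φ` is a `k`-CNF in the wide sense: every clause has at most `k` literals.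
(`Literature.Computability.FineGrained.KCNF.length_le` is exactly this condition.) [Arora–Barak 2009, Def. 2.9 (kCNF);
Impagliazzo–Paturi 2001, §1] [cite: AroraBarak2009, Def. 2.9 (kCNF] -/
def IsWidthLE (k : ℕ) (φ : CNF ν) : Prop :=
  ∀ c ∈ φ, c.length ≤ k

/-- `φ` is an E`k`-CNF (exactly-`k`): every clause has exactly `k` literals on `k` pairwise
distinct variables. [Håstad, *Some optimal inapproximability results*, J. ACM 48 (2001), §2
(E3-SAT); Arora–Barak 2009, §22.4] [cite: AroraBarak2009, §22.4] -/
def IsExactWidth (k : ℕ) (φ : CNF ν) : Prop :=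
  ∀ c ∈ φ, c.length = k ∧ (c.map Prod.fst).Nodup

/-- An E`k`-CNF is a `k`-CNF. [Arora–Barak 2009, §22.4] [cite: AroraBarak2009, §22.4] -/
theorem IsExactWidth.isWidthLE {k : ℕ} {φ : CNF ν} (h : φ.IsExactWidth k) : φ.IsWidthLE k :=
  fun c hc => (h c hc).1.le

/-- Width bounds are monotone in `k`. [Arora–Barak 2009, Def. 2.9] [cite: AroraBarak2009, Def. 2.9] -/
theorem IsWidthLE.mono {k k' : ℕ} {φ : CNF ν} (h : φ.IsWidthLE k) (hk : k ≤ k') :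
    φ.IsWidthLE k' :=
  fun c hc => (h c hc).trans hk

/-- Width `≤ k` is decidable (syntactic check). [Arora–Barak 2009, Def. 2.9] [cite: AroraBarak2009, Def. 2.9] -/
instance (k : ℕ) (φ : CNF ν) : Decidable (φ.IsWidthLE k) :=
  inferInstanceAs (Decidable (∀ c ∈ φ, c.length ≤ k))

/-- Exact width `k` is decidable (syntactic check). [Håstad 2001, §2] [cite: Hastad2001, §2] -/
instance [DecidableEq ν] (k : ℕ) (φ : CNF ν) : Decidable (φ.IsExactWidth k) :=
  inferInstanceAs (Decidable (∀ c ∈ φ, c.length = k ∧ (c.map Prod.fst).Nodup))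

/-! ### MAX-SAT value -/

/-- The fraction of clauses of `φ` satisfied by `σ`, in `ℚ`. Convention (documented junk /
vacuity): for the empty CNF the value is `1` (all of its clauses are satisfied).
[Arora–Barak 2009, §11.2 (`val(φ)`, MAX-3SAT)] [cite: AroraBarak2009, §11.2 ( val(φ] -/
def satisfiedFraction (φ : CNF ν) (σ : ν → Bool) : ℚ :=
  if φ.numClauses = 0 then 1 else (φ.countP fun c => c.eval σ : ℚ) / φ.numClauses

/-- The MAX-SAT value `val(φ)`: the maximum over assignments of the fraction of satisfied
clauses. The maximum is taken over the finitely many assignments to `φ.vars` (extended by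
`false` elsewhere, which does not affect the value). Junk value `1` on the empty CNF
(see `satisfiedFraction`). [Arora–Barak 2009, §11.2, Def. 11.1; Håstad 2001, §2] [cite: AroraBarak2009, §11.2  Def. 11.1] -/
def maxSatFraction [DecidableEq ν] (φ : CNF ν) : ℚ :=
  (Finset.univ : Finset (φ.vars → Bool)).sup' Finset.univ_nonempty fun τ =>
    φ.satisfiedFraction fun x => if h : x ∈ φ.vars then τ ⟨x, h⟩ else false

/-- The satisfied fraction is at most `1`. [Arora–Barak 2009, §11.2] [cite: AroraBarak2009, §11.2] -/
theorem satisfiedFraction_le_one (φ : CNF ν) (σ : ν → Bool) : φ.satisfiedFraction σ ≤ 1 := by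
  unfold satisfiedFraction numClauses
  split_ifs with h
  · exact le_rfl
  · rw [div_le_one (by exact_mod_cast Nat.pos_of_ne_zero h)]
    exact_mod_cast List.countP_le_length

/-- All clauses are satisfied iff the satisfied fraction is `1`. [Arora–Barak 2009, §11.2] [cite: AroraBarak2009, §11.2] -/
def satisfiedFraction_eq_one_iff : Prop :=
  ∀ (φ : CNF ν) (σ : ν → Bool),
    φ.satisfiedFraction σ = 1 ↔ φ.eval σ = true

/-- `val(φ) = 1` iff `φ` is satisfiable. [Arora–Barak 2009, §11.2] [cite: AroraBarak2009, §11.2] -/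
def maxSatFraction_eq_one_iff : Prop :=
  ∀ [DecidableEq ν] (φ : CNF ν),
    φ.maxSatFraction = 1 ↔ φ.Satisfiable

/-- Junk value: `val([]) = 1` (documented convention). [Arora–Barak 2009, §11.2] [cite: AroraBarak2009, §11.2] -/
@[simp] theorem maxSatFraction_nil [DecidableEq ν] : maxSatFraction ([] : CNF ν) = 1 := by
  simp [maxSatFraction, satisfiedFraction, numClauses]

end CNF

/-! ### Propositional formulas -/

/-- Propositional formulas over variables `ν` in the basis `¬, ∧, ∨` with constants.
[Cook 1971, §1; Arora–Barak 2009, §2.3 (Boolean formulae)] [cite: Cook1971, §1] -/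
inductive PropForm (ν : Type u) : Type u
  /-- a variable -/
  | var : ν → PropForm ν
  /-- a truth constant `⊤`/`⊥` -/
  | const : Bool → PropForm ν
  /-- negation -/
  | neg : PropForm ν → PropForm ν
  /-- conjunction -/
  | conj : PropForm ν → PropForm ν → PropForm ν
  /-- disjunction -/
  | disj : PropForm ν → PropForm ν → PropForm ν
  deriving DecidableEq, Repr

namespace PropForm

/-- The truth value of a formula under an assignment. [Arora–Barak 2009, §2.3] [cite: AroraBarak2009, §2.3] -/
def eval (σ : ν → Bool) : PropForm ν → Bool
  | var x => σ x
  | const b => b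
  | neg φ => !φ.eval σ
  | conj φ ψ => φ.eval σ && ψ.eval σ
  | disj φ ψ => φ.eval σ || ψ.eval σ

/-- A formula is a tautology if it is true under every assignment.
[Cook 1971, §1 ({tautologies}); Arora–Barak 2009, Example 2.21] [cite: Cook1971, §1 ({tautologies}] -/
def IsTautology (φ : PropForm ν) : Prop :=
  ∀ σ : ν → Bool, φ.eval σ = true

/-- A formula is satisfiable if it is true under some assignment. [Cook 1971, §1] [cite: Cook1971, §1] -/
def Satisfiable (φ : PropForm ν) : Prop :=
  ∃ σ : ν → Bool, φ.eval σ = true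

/-- The size of a formula: its number of connectives, constants and variable occurrences
(nodes of the syntax tree). [Arora–Barak 2009, §2.3] [cite: AroraBarak2009, §2.3] -/
def size : PropForm ν → ℕ
  | var _ => 1
  | const _ => 1
  | neg φ => φ.size + 1
  | conj φ ψ => φ.size + ψ.size + 1
  | disj φ ψ => φ.size + ψ.size + 1

/-- Every formula has positive size. [Arora–Barak 2009, §2.3] [cite: AroraBarak2009, §2.3] -/
theorem size_pos (φ : PropForm ν) : 0 < φ.size := by
  cases φ <;> simp [size]

/-- `φ` is a tautology iff `¬φ` is unsatisfiable. [Cook 1971, §1] [cite: Cook1971, §1] -/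
theorem isTautology_iff_not_satisfiable_neg (φ : PropForm ν) :
    φ.IsTautology ↔ ¬ (neg φ).Satisfiable := by
  simp [IsTautology, Satisfiable, eval]

/-- The formula of a clause list read as a CNF (conjunction of disjunctions of literals).
[Arora–Barak 2009, Def. 2.9] [cite: AroraBarak2009, Def. 2.9] -/
def ofCNF (φ : CNF ν) : PropForm ν :=
  φ.foldr (fun c acc => conj (c.foldr (fun l d => disj
    (if l.2 then var l.1 else neg (var l.1)) d) (const false)) acc) (const true)

/-- `ofCNF` is semantically correct. [Arora–Barak 2009, Def. 2.9] [cite: AroraBarak2009, Def. 2.9] -/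
theorem eval_ofCNF (φ : CNF ν) (σ : ν → Bool) : (ofCNF φ).eval σ = φ.eval σ := by
  induction φ with
  | nil => rfl
  | cons c φ ih =>
    simp only [ofCNF, List.foldr_cons, eval, CNF.eval_cons] at ih ⊢
    rw [ih]
    congr 1
    induction c with
    | nil => rfl
    | cons l c ihc =>
      simp only [List.foldr_cons, eval, Clause.eval, List.any_cons] at ihc ⊢
      rw [ihc]
      congr 1
      rcases l with ⟨x, _ | _⟩ <;> simp [eval, Literal.eval]

end PropForm

/-! ### Boolean encodings of literals, CNFs and formulas -/

/-- The encoding of a literal over `ℕ` as a bit string: `boolPair (binary variable) [polarity]`.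
[Arora–Barak 2009, §0.1, §2.3] [cite: AroraBarak2009, §0.1  §2.3] -/
def encodingLiteral : Encoding (Literal ℕ) Bool :=
  encodingNatBool.pairBool encodingBoolBool

/-- The encoding of a clause over `ℕ`: the `listBool` encoding of its literals.
[Arora–Barak 2009, §0.1, §2.3] [cite: AroraBarak2009, §0.1  §2.3] -/
def encodingClause : Encoding (Clause ℕ) Bool :=
  encodingLiteral.listBool

/-- The encoding of a CNF over `ℕ` as a bit string: lists of lists of literals via `listBool`.
This fixes the meaning of `SAT ⊆ {0,1}*`. [Cook 1971, §1; Arora–Barak 2009, §2.3] [cite: Cook1971, §1] -/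
def encodingCNF : Encoding (CNF ℕ) Bool :=
  encodingClause.listBool

namespace PropForm

/-- Prefix code for formulas over `ℕ` (Polish notation with 2–3 tag bits per node):
`var n ↦ 00·boolPair (encodeNat n) []`, `const b ↦ 01b`, `neg φ ↦ 10·code φ`,
`conj φ ψ ↦ 110·code φ·code ψ`, `disj φ ψ ↦ 111·code φ·code ψ`. [Arora–Barak 2009, §0.1] [cite: AroraBarak2009, §0.1] -/
def code : PropForm ℕ → List Bool
  | var n => false :: false :: boolPair (encodeNat n) []
  | const b => [false, true, b]
  | neg φ => true :: false :: code φ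
  | conj φ ψ => true :: true :: false :: (code φ ++ code ψ)
  | disj φ ψ => true :: true :: true :: (code φ ++ code ψ)

/-- Fuel-indexed decoder for `PropForm.code`: returns the decoded formula and the unread
suffix. [Arora–Barak 2009, §0.1] [cite: AroraBarak2009, §0.1] -/
def decodeAux : ℕ → List Bool → Option (PropForm ℕ × List Bool)
  | 0, _ => none
  | _ + 1, false :: false :: w => some (var (decodeNat (boolUnpair w).1), (boolUnpair w).2)
  | _ + 1, false :: true :: b :: w => some (const b, w)
  | n + 1, true :: false :: w => (decodeAux n w).map fun p => (neg p.1, p.2)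
  | n + 1, true :: true :: false :: w => do
    let p ← decodeAux n w
    let q ← decodeAux n p.2
    return (conj p.1 q.1, q.2)
  | n + 1, true :: true :: true :: w => do
    let p ← decodeAux n w
    let q ← decodeAux n p.2
    return (disj p.1 q.1, q.2)
  | _ + 1, _ => none

/-- Correctness of the prefix decoder: with fuel at least `φ.size`, decoding `code φ ++ rest`
yields `φ` and `rest`. [Arora–Barak 2009, §0.1] [cite: AroraBarak2009, §0.1] -/
theorem decodeAux_code_append (φ : PropForm ℕ) {n : ℕ} (hn : φ.size ≤ n) (rest : List Bool) :
    decodeAux n (code φ ++ rest) = some (φ, rest) := by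
  induction φ generalizing n rest with
  | var m =>
    cases n with
    | zero => simp [size] at hn
    | succ n =>
      have : boolPair (encodeNat m) [] ++ rest = boolPair (encodeNat m) rest := by
        simp [boolPair]
      simp [code, decodeAux, this]
  | const b =>
    cases n with
    | zero => simp [size] at hn
    | succ n => simp [code, decodeAux]
  | neg φ ih =>
    cases n with
    | zero => simp [size] at hn
    | succ n =>
      simp only [size, Nat.add_le_add_iff_right] at hn
      simp [code, decodeAux, ih hn]
  | conj φ ψ ihφ ihψ =>
    cases n with
    | zero => simp [size] at hn
    | succ n =>
      simp only [size, Nat.add_le_add_iff_right] at hn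
      have h₁ : φ.size ≤ n := le_trans (Nat.le_add_right _ _) hn
      have h₂ : ψ.size ≤ n := le_trans (Nat.le_add_left _ _) hn
      simp [code, decodeAux, List.append_assoc, ihφ h₁, ihψ h₂]
  | disj φ ψ ihφ ihψ =>
    cases n with
    | zero => simp [size] at hn
    | succ n =>
      simp only [size, Nat.add_le_add_iff_right] at hn
      have h₁ : φ.size ≤ n := le_trans (Nat.le_add_right _ _) hn
      have h₂ : ψ.size ≤ n := le_trans (Nat.le_add_left _ _) hn
      simp [code, decodeAux, List.append_assoc, ihφ h₁, ihψ h₂]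

end PropForm

/-- The encoding of propositional formulas over `ℕ` as bit strings:
`φ ↦ boolPair (unary φ.size) (PropForm.code φ)`; the unary size serves as decoding fuel.
This fixes the meaning of `TAUT ⊆ {0,1}*`. [Cook 1971, §1; Arora–Barak 2009, §0.1, §2.3] [cite: Cook1971, §1] -/
def encodingPropForm : Encoding (PropForm ℕ) Bool where
  encode φ := boolPair (unaryEncodeNat φ.size) φ.code
  decode w := (PropForm.decodeAux (unaryDecodeNat (boolUnpair w).1) (boolUnpair w).2).map
    Prod.fst
  decode_encode φ := by
    have h := PropForm.decodeAux_code_append φ le_rfl []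
    rw [List.append_nil] at h
    simp [boolUnpair_boolPair, unary_decode_encode_nat, h]

/-! ### The languages SAT, kSAT, EkSAT, UNSAT, kUNSAT, TAUT, kTAUT -/

/-- `SAT ⊆ {0,1}*`: encodings of satisfiable CNF formulas.
[Cook 1971, Thm 1; Karp 1972, §4 (SATISFIABILITY); Arora–Barak 2009, Def. 2.9–2.10] [cite: Cook1971, Thm 1] -/
def SAT : Language Bool :=
  encodingCNF.toLanguage {φ | φ.Satisfiable}

/-- `kSAT k ⊆ {0,1}*`: encodings of satisfiable CNFs all of whose clauses have at most `k`
literals. [Cook 1971, Thm 2 (k = 3); Arora–Barak 2009, §2.3 (3SAT); Sipser, §7.4] [cite: Cook1971, Thm 2 (k = 3] -/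
def kSAT (k : ℕ) : Language Bool :=
  encodingCNF.toLanguage {φ | φ.IsWidthLE k ∧ φ.Satisfiable}

/-- `EkSAT k ⊆ {0,1}*`: encodings of satisfiable E`k`-CNFs (every clause has exactly `k`
literals on distinct variables). [Håstad 2001, §2 (E3-SAT); Arora–Barak 2009, §22.4] [cite: Hastad2001, §2 (E3-SAT] -/
def EkSAT (k : ℕ) : Language Bool :=
  encodingCNF.toLanguage {φ | φ.IsExactWidth k ∧ φ.Satisfiable}

/-- `UNSAT ⊆ {0,1}*`: encodings of unsatisfiable CNF formulas (note: not the set complement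
`SATᶜ`, which also contains the non-codewords; cf. `Encoding.compl_toLanguage_eq`).
[Arora–Barak 2009, §2.6.1; Cook–Reckhow 1979, §1] [cite: AroraBarak2009, §2.6.1] -/
def UNSAT : Language Bool :=
  encodingCNF.toLanguage {φ | ¬ φ.Satisfiable}

/-- `kUNSAT k ⊆ {0,1}*`: encodings of unsatisfiable CNFs of width at most `k`.
[Arora–Barak 2009, §2.6.1; Ben-Sasson–Wigderson 2001, §1 (k-CNF refutations)] [cite: AroraBarak2009, §2.6.1] -/
def kUNSAT (k : ℕ) : Language Bool :=
  encodingCNF.toLanguage {φ | φ.IsWidthLE k ∧ ¬ φ.Satisfiable}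

/-- `TAUT ⊆ {0,1}*`: encodings of propositional tautologies.
[Cook 1971, §1 ({tautologies}); Cook–Reckhow 1979, §1; Arora–Barak 2009, Example 2.21] [cite: Cook1971, §1 ({tautologies}] -/
def TAUT : Language Bool :=
  encodingPropForm.toLanguage {φ | φ.IsTautology}

/-- `kTAUT k ⊆ {0,1}*`: encodings of `k`-DNF tautologies (clause lists of width `≤ k` that are
true under every assignment when read as a DNF). [Cook 1971, Thm 2 (DNF tautologies with at
most three literals per disjunct)] [cite: Cook1971, Thm 2 (DNF tautologies with at most thre] -/
def kTAUT (k : ℕ) : Language Bool :=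
  encodingCNF.toLanguage {φ | φ.IsWidthLE k ∧ φ.IsDNFTautology}

open scoped Notation

/-- A codeword is in `SAT` iff the CNF is satisfiable. [Cook 1971, Thm 1] [cite: Cook1971, Thm 1] -/
theorem mem_SAT_iff (φ : CNF ℕ) : encodingCNF.encode φ ∈ SAT ↔ φ.Satisfiable :=
  encodingCNF.mem_toLanguage_iff _ φ

/-- A codeword is in `kSAT k` iff the CNF has width `≤ k` and is satisfiable.
[Arora–Barak 2009, §2.3] [cite: AroraBarak2009, §2.3] -/
theorem mem_kSAT_iff (k : ℕ) (φ : CNF ℕ) :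
    encodingCNF.encode φ ∈ kSAT k ↔ φ.IsWidthLE k ∧ φ.Satisfiable :=
  encodingCNF.mem_toLanguage_iff _ φ

/-- A codeword is in `TAUT` iff the formula is a tautology. [Cook 1971, §1] [cite: Cook1971, §1] -/
theorem mem_TAUT_iff (φ : PropForm ℕ) : encodingPropForm.encode φ ∈ TAUT ↔ φ.IsTautology :=
  encodingPropForm.mem_toLanguage_iff _ φ

/-- `EkSAT k ⊆ kSAT k`. [Arora–Barak 2009, §22.4] [cite: AroraBarak2009, §22.4] -/
theorem EkSAT_le_kSAT (k : ℕ) : EkSAT k ≤ kSAT k :=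
  encodingCNF.toLanguage_mono fun _ h => ⟨h.1.isWidthLE, h.2⟩

/-- `kSAT k ⊆ SAT`. [Arora–Barak 2009, §2.3] [cite: AroraBarak2009, §2.3] -/
theorem kSAT_le_SAT (k : ℕ) : kSAT k ≤ SAT :=
  encodingCNF.toLanguage_mono fun _ h => h.2

/-- `SAT` and `UNSAT` are disjoint (their union is the set of codewords, not all of `{0,1}*`).
[Arora–Barak 2009, §2.6.1] [cite: AroraBarak2009, §2.6.1] -/
theorem SAT_disjoint_UNSAT : Disjoint SAT UNSAT := by
  refine Set.disjoint_left.2 ?_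
  rintro _ ⟨φ, hφ, rfl⟩ ⟨ψ, hψ, h⟩
  rw [encodingCNF.encode_injective h] at hψ
  exact hψ hφ

/-- `SAT ∈ NP` (the satisfying assignment restricted to `φ.vars` is the certificate).
[Cook 1971, Thm 1; Arora–Barak 2009, Example 2.2] [cite: Cook1971, Thm 1] -/
def SAT_mem_NP : Prop :=
  SAT ∈ Nondeterministic.NP

/-- `kSAT k ∈ NP`. [Arora–Barak 2009, §2.3] [cite: AroraBarak2009, §2.3] -/
def kSAT_mem_NP : Prop :=
  ∀ (k : ℕ),
    kSAT k ∈ Nondeterministic.NP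

/-- `kSAT k ≤ₚ SAT` (identity on well-formed width-`≤ k` codewords, a fixed non-member
otherwise). [Arora–Barak 2009, §2.3] [cite: AroraBarak2009, §2.3] -/
def kSAT_karpReducible_SAT : Prop :=
  ∀ (k : ℕ),
    kSAT k ≤ₚ SAT

/-- `TAUT ∈ coNP` (a falsifying assignment certifies the complement; non-codewords are
recognised in polynomial time). [Cook 1971, §1; Arora–Barak 2009, Example 2.21] [cite: Cook1971, §1] -/
def TAUT_mem_coNP : Prop :=
  TAUT ∈ coNP

/-! ### Occurring variables are below `numVars` (appended 2026-08-15)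

The canonical home of the bound "every variable of a literal of a clause of `φ` is `< numVars φ`",
next to the definition of `CNF.numVars`. The same statement was proved three times downstream for
want of it here (`Literature.Computability.FineGrained.CliqueRed.lt_numVars_of_mem` in
`FineGrained/CliqueETHReductionProgram.lean`, and `CNF.lt_numVars_of_mem` with its companion
`CNF.lt_numVars_of_mem_vars` in `Complexity/ParsimoniousThreeCNF.lean`); those twins keep their
names for now — the second pair occupies the names `CNF.lt_numVars_of_mem(_vars)` of this very
namespace, hence the name below — and can be retired onto this lemma by a librarian. -/

namespace CNF

/-- **Every occurring variable is below `numVars`**: if the literal `l` belongs to a clause `c` of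
`φ`, then `l.1 < φ.numVars` (`numVars φ` is `1 +` the largest occurring variable, `0` if none;
members of a list are bounded by its `foldr max`).
[Impagliazzo–Paturi 2001, §1 (`n` = the number of variables); Arora–Barak 2009, Def. 2.9]
[folklore] -/
theorem lt_numVars_of_mem_of_mem {φ : CNF ℕ} {c : Clause ℕ} (hc : c ∈ φ) {l : Literal ℕ}
    (hl : l ∈ c) : l.1 < φ.numVars := by
  have hmem : l.1 + 1 ∈ φ.flatten.map fun l => l.1 + 1 :=
    List.mem_map.2 ⟨l, List.mem_flatten.2 ⟨c, hc, hl⟩, rfl⟩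
  have key : ∀ (L : List ℕ) (v : ℕ), v ∈ L → v ≤ L.foldr max 0 := by
    intro L
    induction L with
    | nil => intro v hv; simp at hv
    | cons a L ih =>
      intro v hv
      simp only [List.foldr_cons]
      rcases List.mem_cons.1 hv with rfl | hv
      · exact le_max_left _ _
      · exact (ih v hv).trans (le_max_right _ _)
  exact Nat.lt_of_succ_le (key _ _ hmem)

end CNF

end Literature.Computability.Complexity
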